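import Literature.MathematicalPhysics.QuantumFieldTheory.Balaban1983to89.B13ChainJointNonvacuity226
import Literature.MathematicalPhysics.QuantumFieldTheory.Balaban1983to89.B13EntrywiseBlockNumerals
import Literature.MathematicalPhysics.QuantumFieldTheory.Balaban1983to89.B13RungDialNumerals
import Literature.MathematicalPhysics.QuantumFieldTheory.Balaban1983to89.NodeOLettersOfWalksPerturbative

/-!
# `Balaban1983to89.B13ChainJointNonvacuityPrefactors` — T. Bałaban, *Renormalization group approach to lattice gauge field
theories. II. Cluster expansions*, Commun. Math. Phys. **116** (1988) 1–22, doi:10.1007/bf01239022 [Balaban1988RG2Cluster]: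
**THE JOINT NON-VACUITY WITNESS TWO STOREYS UP — the N10 junction's NUMERICAL binders at ONE record AND ONE reference package,
PREFACTORS GIVEN** (p. 21: *"The assumptions allow finally us to fix all the constants, or rather bounds on these constants."*)

statement-level skeleton of published theorems with citation tags; proofs where landed; nothing here is a claim about the
Yang–Mills mass gap

CITATION HEADER (verbatim).  p. 9 [PDF 9], Lemma 1: *"There exist absolute constants C₁, C₂, q, for which |V′_k(Y, 𝐔, 𝐉, B)| ≦
E₀ε₁C₁M^q exp C₂κ₁ exp(−(1 − 2δ)κd_k(Y)). (1.36)"*; p. 11, Lemma 2 (1.43); p. 16, after (2.18): *"We assume that ⅛(κ₁ − 1) ≧ (1 − 3δ)κ,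
C₃ ≦ E₀C₁, and q ≧ 8."*; p. 21 [PDF 21], closing paragraph: *"The assumptions allow finally us to fix all the constants, or rather bounds on
these constants."*  NOT PRINTED: every explicit number below — WITNESS DATA for typed hypothesis lists, not Bałaban's constants.

WHY THIS FILE (cell `pub-ymgap`, HUMAN RULING D-0062 Track A ∕ D-0149 width seats, node N10 = [B13], seat `pub-ymgap-dag-n10-w3` g3; an
own-stem successor of this seat's `B13EntrywiseBlockNumerals` (p598246) and `B13RungDialNumerals` (p602029) over n10-w1's
`B13ChainJointNonvacuity226` (p586209)).  Director's STANDING A6 RULE (№189): a junction whose binders are hypotheses about hidden objects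
ships a joint satisfiability witness of its NUMERICAL binders.  The junction of record (module 67 `Thm/…EntrywiseNumeralsDecorated` and its
located editions 67R ∕ 67RD ∕ 67RDL) displays ≈ 160 binders; their NUMERICAL sub-class had, so far, witnesses in PIECES:
`chain_joint_nonvacuous_226` (the chain's 69 conjuncts + `hN` + `hτ2` + the (2.24)–(2.26) numerals + `hPa`, at ONE record — its HONEST SCOPE
excludes *«the Lemma 1–2 located inputs of the junction (`K K′ K₂ m₂ θ₁`, `hC`, `hfloor`)»*), `B13NodeTorusConsts.consts_meets_lemma1_thresholds`
(the (1.36) constant inequality `hC` met at `K = K′ = 0` only — a witness at which the per-term bounds `h124 ∕ h130` force the ZERO term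
tower), and this seat's `exists_letters ∕ exists_binders` (NODE A's rate budget + expansion-constant floor; the rung's located dials) at
ABSTRACT letters — not at the DERIVED letters `K̄ ∕ μ ∕ κ_C⋆ ∕ B_Γ ∕ etaMax ∕ c_V ∕ c_V₀` of an actual admissible `RefPackage`, and not at
the chain's record.  THIS FILE joins them: ONE record, ONE `cp`, ONE admissible reference package, for EVERY POSITIVE prefactor triple
`K K′ K₂` of (1.24) ∕ (1.30) ∕ (1.38) (the in-edge O(1)'s of [I] (3.54), [15] Prop. 4, [13] (3.108)) and every choice of NODE A's letters.

WHAT THIS FILE PROVES (0 `sorry`; two transparent `def`s — the record family `constsQ8A` and the reference package `refPackageJoint` —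
no structure ∕ instance ∕ notation ∕ new named fact).
§1 TWO LOCATED REMARKS (pure algebra; the reason no witness «for every K at FIXED α₄» exists, and what a non-degenerate joint inhabitant's
   prefactors look like): `prefactors_le_of_hC_hτ2` — `hC ∧ hτ2 ∧ 0 ≤ θ₁ ⟹ K·K₀(64,8)·2(6L)⁴·e·e^{κ₁(12⁴−1)∕8} + 2·64K′·K₀(64,8)·1344 ≤
   (1 − θ₁)·α₄∕2`: the (1.24)∕(1.30) prefactors a joint inhabitant admits are bounded by the record's ACTIVITY LETTER `α₄` against
   `e^{(12⁴−1)κ₁∕8}` (print's per-term (1.24) bound carries `ε₁`, p. 9 — consistent: the typed `K` reads `ε₁·O(1)`); `K_le_of_hC_hτ2` — the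
   same solved for `K`; `alpha4_le_of_count` — the θ-free count binder `hcount` of the junction, at any term with non-empty 𝐃-support, caps
   `α₄ ≤ a₅·|Z|∕(2K₀(64,8)·#⋃𝐃)` (so a joint inhabitant WITH OBJECTS has `α₄` tied to the support ratio; recorded, not papered over).
§2 `constsQ8A M α₄` — n10-w1's `constsQ8 M` (itself lit-balaban's `B13Lemma3TorusNonvacuity.consts` with `q := 8`, `C₂ := 50`, `M` free) with
   the activity letter `α₄` a DIAL and `ε₁ := α₄·ε₁t·M⁻⁸·e^{−49κ₁t}`, so that the three products `ε₂ = E₀ε₁K₀`, `C₃ε₁`, `1∕|τ|` through which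
   `ε₁, α₄` enter the 41 Lemma-3 conjuncts DO NOT MOVE (`constsQ8A_ε₁K₀ ∕ _eps2 ∕ _C3act_ε₁ ∕ _invTau`); ★ `constsQ8A_spec` — the chain's 69
   conjuncts VERBATIM on the whole two-parameter family (`M ≥ κw + 1`, `α₄ > 0`), transferred from `constsQ8_spec` BY NAME; `constsQ8A_numerics`
   (`hN` shape), `constsQ8A_invTau_zero` (`hτ2` shape), `constsQ8A_EM` (the (1.36) prefactor of the family is `2α₄·ε₁t·e^{κ₁t}` — it GROWS with
   the dial, which is what lets `hC` absorb any given `K, K′`: print's order of choice, p. 21).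
§3 `refPackageJoint ν F η R_σ` — a reference package with unit rates, accretivity constants `m₀ = 2, m_{A,0} = 1`, all three expansion
   constants `K̄_L = K̄_P = K̄_A := F`, `n_B = 1`, `d_m = ν`; `refPackageJoint_admissible` (`0 ≤ F`, `0 < η ≤ 1`), `positiveRates_refPackageJoint`,
   `etaMax_refPackageJoint_eq` (the ceiling `etaMax` is `η`-, `R_σ`- and `R₁`-FREE — `rfl`), `etaMax_refPackageJoint_pos_le` (`0 < etaMax ≤ 1`).
§4 ★★★ `junction_numerals_joint_witness` — for every `0 < K, K′, K₂`, every `m₂`, every `m ν m′ mF c₀ rC` and `BΔ ≥ 0` THERE ARE `c cp rf R₁ θ₀ α θ₁ R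
   r γ₂ r_P ρΔ ηΔ μΔ M₁` meeting AT ONCE, in the junction's binder SHAPES: (0) `c = constsQ8A M α₄` with `M ≥ κw + 1`, `α₄ > 0` (so the 69
   conjuncts, `constsQ8A_spec`); (1) `hN`, `hτ2`, `h12`, `hL8`, `hE hε hC₁ hα hM`; (2) ★ the Lemma 1–2 located NUMERICAL inputs WITH THE GIVEN
   PREFACTORS `hK hK′ hθ₁0 hθ₁1 hC`, `hK₂ hR hε3 hfloor`, `hκp`, `hr hr1`; (3) ★ the rung at `rf`: `hrf`, `hR₁def` (`R₁ = R₁⋆(rf)`), `hp`, `hη`,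
   `hθ₀def` (`θ₀ = θ₀max` at rf's DERIVED letters), `0 < θ₀`, `0 < α`, `hαloc`, `hRσloc`, `hKdim hεL hκL hKL hεA hκA hKA hmA`; (4) ★ NODE A's
   `hηΔ hP2 hμΔ hbudget hkbar` at `cp.κ₁` and `rf.εP ∕ rf.kapP ∕ rf.KbarP`; (5) the (2.24)–(2.26) located numerals at rf's letters and the record's
   OWN `α₄ M κ₁` (`0 < γ₂ ≤ γ₂max`, `M⁴min ≤ c.M⁴`) and p. 17's `a ≤ γ₂r_P²`.  ORDER OF CHOICE inside the proof (no circularity, p. 21):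
   `α₄` from `(K, K′)` → `cp.κ₁ := κ₁t + 1` → NODE A's `ηΔ ρΔ` and the floor `F := kbarFloor …` → the package's `η := etaMax` (η-free) → `θ₀ :=
   θ₀max`, `R_σ := rsigmaMin` (R_σ-free letters) → `M := κw + 1 + M⁴min(rf's letters, α₄, κ₁t) + 27m₂K₂` → `ε₁` (inside `constsQ8A`) last.
§5 (v1.1, append-only) THE OTHER DIRECTION: `constsQ8A_hC_of_le` and ★★ `junction_numerals_joint_witness_of_activity` — for EVERY activity letter
   `0 < α₄` (as small as the count binder `hcount` wants) the SAME package with EXPLICIT positive prefactors `K := α₄ε₁t e^{κ₁t}∕(2P)`,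
   `K′ := α₄ε₁t e^{κ₁t}∕(2P′)` (`P := K₀(64,8)·2(6·8)⁴·e·e^{(12⁴−1)κ₁t∕8}`, `P′ := 2·64·1344·K₀(64,8)`) and `c.α₄ = α₄` — the branch compatible with objects.

HONEST SCOPE.  «The NUMERICAL binders of the junction of record jointly consistent AS TYPED, for every positive prefactor triple and every
choice of NODE A's letters; nothing about Bałaban's constants» — the numbers are astronomically far from physical ones (e.g. `ε₁ ∝
e^{−49κ₁t}`, `κ₁t > 8·10⁴`), as in every witness of this chain.  The OBJECT binders of the junction (`hEL hGJ hKacc hKfar hKmult hcount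
h124 h130 hGl hW hKW …`, the (1.33) index data, the term kernels) are NOT inhabited here (their inhabitants: n10-w2's `B13EntrywiseBlock*Witness`,
this seat's `Node00/CarriersB13*TowerWitness`, n10-w1's (α)); a single inhabitant of all ≈ 160 binders of the junction is NOT claimed, and
§1 records WHY the activity dial that absorbs `K, K′` here is capped by `hcount` once objects are present.  Count-neutral; N10 NOT discharged;
K1⁷ NOT claimed; one finite four-torus programme at fixed ε; nothing continuum ∕ ℝ⁴ ∕ OS ∕ mass-gap ∕ Clay.  n10-w1's, n10-b's and
lit-balaban's files are imported UNCHANGED.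
-/

noncomputable section

namespace Literature.MathematicalPhysics.QuantumFieldTheory.Balaban1983to89.B13ChainJointNonvacuityPrefactors

open Literature.MathematicalPhysics.QuantumFieldTheory.Balaban1983to89
open Literature.MathematicalPhysics.QuantumFieldTheory.Balaban1983to89.B12TreeDecay (kappa₀ K₀ K₀_pos kappa₀_nonneg)
open Literature.MathematicalPhysics.QuantumFieldTheory.Balaban1983to89.B13Bound143 (invTau R12)
open Literature.MathematicalPhysics.QuantumFieldTheory.Balaban1983to89.B13Lemma3WindowNonvacuity
  (Kw κ₀w κw δw μw α₆w Aup A₁w A₂w ε₂w aw)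
open Literature.MathematicalPhysics.QuantumFieldTheory.Balaban1983to89.B13Lemma3TorusNonvacuity (κ₁t ε₁t)
open Literature.MathematicalPhysics.QuantumFieldTheory.Balaban1983to89.B13Lemma3TorusSocket (Lemma3Numerics)
open Literature.MathematicalPhysics.QuantumFieldTheory.Balaban1983to89.B13NodeTorusFamilyNonvacuity (aw_pos)
open Literature.MathematicalPhysics.QuantumFieldTheory.Balaban1983to89.B13Bound226Numerals
  (theta0Max gamma2Max m4Min theta0Max_pos gamma2Max_pos m4Min_nonneg)
open Literature.MathematicalPhysics.QuantumFieldTheory.Balaban1983to89.B13ChainJointNonvacuity226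
  (constsQ8 constsQ8_spec constsQ8_ε₁_pos constsQ8_invTau_zero κw_lower)
open Literature.MathematicalPhysics.QuantumFieldTheory.Balaban1983to89.B13EntrywiseBlockNumerals (kbarFloor kbarFloor_nonneg)
open Literature.MathematicalPhysics.QuantumFieldTheory.Balaban1983to89.B13RungDialNumerals
  (radiusStar alphaMax rsigmaMin radiusStar_pos alphaMax_pos)
open Literature.MathematicalPhysics.QuantumFieldTheory.Balaban1983to89.NodeOLettersOfWalksAcross (WalkPackage)
open Literature.MathematicalPhysics.QuantumFieldTheory.Balaban1983to89.NodeOLettersOfWalksPerturbative (RefPackage)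
open Literature.MathematicalPhysics.QuantumFieldTheory.Balaban1983to89.NodeOLettersOfWalksAcross.WalkPackage
  (kapCStar_spec rhoE_pos mu_pos Kbar_nonneg BΓ_nonneg)
open Literature.MathematicalPhysics.QuantumFieldTheory.Balaban1983to89.NodeOLettersOfWalksPerturbative.RefPackage
  (admissible_toWalkPackage cV_nonneg cV₀_nonneg c0_nonneg)

/-! ## §1. Two located remarks: what `hC ∧ hτ2` say about the prefactors, and what `hcount` says about the activity letter -/

section Located

variable (c : B13.Consts)

/-- **LOCATED REMARK 1.**  In the junction of record, the (1.36) constant inequality `hC` (left side: the (1.24) prefactor `K` times the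
small-polymer loss `e^{κ₁(12⁴−1)∕8}` of the torus Lemma 1, plus the (1.30) prefactor `K′`) and the (2.18) bound `hτ2` (`E₀ε₁C₁α₄⁻¹M^q e^{C₂κ₁}
≤ ½`) share the product `E₀ε₁C₁M^q e^{C₂κ₁}`; together they bound the prefactors by the record's activity letter:
`K·K₀(64,8)·2(6L)⁴·e·e^{κ₁(12⁴−1)∕8} + 2·64K′·K₀(64,8)·1344 ≤ (1 − θ₁)·α₄∕2`.  (Print's per-term bound (1.24) carries the small-field
letter `ε₁` — the typed `K` reads `ε₁·O(1)`; consistent, and the reason a joint witness must let `α₄` grow with `K`.)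
[cite: Balaban1988RG2Cluster, (1.24) p.7 (used p.8), (1.29) p.8, (1.36) p.9, (2.18) p.16, p.21 (closing paragraph)] -/
theorem prefactors_le_of_hC_hτ2 {K K' θ₁ : ℝ} {L : ℕ} (hθ₁1 : θ₁ ≤ 1) (hα : 0 < c.α₄)
    (hC : K * K₀ 64 8 * (2 * (6 * ((L : ℕ) : ℝ)) ^ 4) * Real.exp 1 * Real.exp ((1 / 8) * c.κ₁ * (12 ^ 4 - 1)) +
        2 * (64 * K') * K₀ 64 8 * 1344 ≤ (1 - θ₁) * (c.E₀ * c.ε₁ * c.C₁ * c.M ^ c.q * Real.exp (c.C₂ * c.κ₁)))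
    (hτ2 : c.E₀ * c.ε₁ * c.C₁ * c.α₄⁻¹ * c.M ^ c.q * Real.exp (c.C₂ * c.κ₁) ≤ 1 / 2) :
    K * K₀ 64 8 * (2 * (6 * ((L : ℕ) : ℝ)) ^ 4) * Real.exp 1 * Real.exp ((1 / 8) * c.κ₁ * (12 ^ 4 - 1)) +
        2 * (64 * K') * K₀ 64 8 * 1344 ≤ (1 - θ₁) * (c.α₄ / 2) := by
  -- `hτ2` multiplied through by `α₄ > 0`
  have hX : c.E₀ * c.ε₁ * c.C₁ * c.M ^ c.q * Real.exp (c.C₂ * c.κ₁) ≤ c.α₄ / 2 := by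
    have h := mul_le_mul_of_nonneg_left hτ2 hα.le
    have hre : c.α₄ * (c.E₀ * c.ε₁ * c.C₁ * c.α₄⁻¹ * c.M ^ c.q * Real.exp (c.C₂ * c.κ₁)) =
        c.E₀ * c.ε₁ * c.C₁ * c.M ^ c.q * Real.exp (c.C₂ * c.κ₁) := by
      field_simp
    rw [hre] at h
    linarith
  exact hC.trans (mul_le_mul_of_nonneg_left hX (by linarith))

/-- **LOCATED REMARK 1, solved for `K`.**  With `K′ ≥ 0`, `0 ≤ θ₁` and `1 ≤ L`: `K ≤ α₄·e^{−1−κ₁(12⁴−1)∕8} ∕ (2·K₀(64,8)·2(6L)⁴)` — the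
(1.24) prefactor a joint inhabitant of the junction admits is `α₄·e^{−(12⁴−1)κ₁∕8}`-small.
[cite: Balaban1988RG2Cluster, (1.24) p.7 (used p.8), (1.36) p.9, (2.18) p.16] -/
theorem K_le_of_hC_hτ2 {K K' θ₁ : ℝ} {L : ℕ} (hθ₁0 : 0 ≤ θ₁) (hθ₁1 : θ₁ ≤ 1) (hK' : 0 ≤ K') (hα : 0 < c.α₄)
    (hC : K * K₀ 64 8 * (2 * (6 * ((L : ℕ) : ℝ)) ^ 4) * Real.exp 1 * Real.exp ((1 / 8) * c.κ₁ * (12 ^ 4 - 1)) +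
        2 * (64 * K') * K₀ 64 8 * 1344 ≤ (1 - θ₁) * (c.E₀ * c.ε₁ * c.C₁ * c.M ^ c.q * Real.exp (c.C₂ * c.κ₁)))
    (hτ2 : c.E₀ * c.ε₁ * c.C₁ * c.α₄⁻¹ * c.M ^ c.q * Real.exp (c.C₂ * c.κ₁) ≤ 1 / 2) (hL : 1 ≤ L) :
    K ≤ c.α₄ * Real.exp (-1 - (1 / 8) * c.κ₁ * (12 ^ 4 - 1)) / (2 * K₀ 64 8 * (2 * (6 * ((L : ℕ) : ℝ)) ^ 4)) := by
  have h := prefactors_le_of_hC_hτ2 c hθ₁1 hα hC hτ2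
  have hK₀ : 0 < K₀ 64 8 := K₀_pos 64 8
  have hL' : (1 : ℝ) ≤ ((L : ℕ) : ℝ) := by exact_mod_cast hL
  have hP : 0 < 2 * K₀ 64 8 * (2 * (6 * ((L : ℕ) : ℝ)) ^ 4) := by positivity
  have hE : 0 < Real.exp 1 * Real.exp ((1 / 8) * c.κ₁ * (12 ^ 4 - 1)) := by positivity
  -- drop the `K′`-term and the factor `(1 − θ₁) ≤ 1`
  have h1 : K * K₀ 64 8 * (2 * (6 * ((L : ℕ) : ℝ)) ^ 4) * Real.exp 1 * Real.exp ((1 / 8) * c.κ₁ * (12 ^ 4 - 1)) ≤ c.α₄ / 2 := by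
    have hK'nn : 0 ≤ 2 * (64 * K') * K₀ 64 8 * 1344 := by positivity
    have hθ : (1 - θ₁) * (c.α₄ / 2) ≤ c.α₄ / 2 := by nlinarith [hα.le]
    linarith
  rw [le_div_iff₀ hP]
  have hexp : Real.exp (-1 - (1 / 8) * c.κ₁ * (12 ^ 4 - 1)) * (Real.exp 1 * Real.exp ((1 / 8) * c.κ₁ * (12 ^ 4 - 1))) = 1 := by
    rw [← Real.exp_add, ← Real.exp_add, ← Real.exp_zero]; congr 1; ring
  -- multiply `h1` by `2·e^{−1−κ₁(12⁴−1)/8}`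
  have h2 := mul_le_mul_of_nonneg_right h1 (Real.exp_pos (-1 - (1 / 8) * c.κ₁ * (12 ^ 4 - 1))).le
  calc K * (2 * K₀ 64 8 * (2 * (6 * ((L : ℕ) : ℝ)) ^ 4))
      = 2 * (K * K₀ 64 8 * (2 * (6 * ((L : ℕ) : ℝ)) ^ 4) * Real.exp 1 * Real.exp ((1 / 8) * c.κ₁ * (12 ^ 4 - 1)) *
          Real.exp (-1 - (1 / 8) * c.κ₁ * (12 ^ 4 - 1))) := by
        calc K * (2 * K₀ 64 8 * (2 * (6 * ((L : ℕ) : ℝ)) ^ 4))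
            = 2 * (K * K₀ 64 8 * (2 * (6 * ((L : ℕ) : ℝ)) ^ 4)) * 1 := by ring
          _ = 2 * (K * K₀ 64 8 * (2 * (6 * ((L : ℕ) : ℝ)) ^ 4)) *
                (Real.exp (-1 - (1 / 8) * c.κ₁ * (12 ^ 4 - 1)) * (Real.exp 1 * Real.exp ((1 / 8) * c.κ₁ * (12 ^ 4 - 1)))) := by
              rw [hexp]
          _ = _ := by ring
    _ ≤ 2 * (c.α₄ / 2 * Real.exp (-1 - (1 / 8) * c.κ₁ * (12 ^ 4 - 1))) := by linarith
    _ = c.α₄ * Real.exp (-1 - (1 / 8) * c.κ₁ * (12 ^ 4 - 1)) := by ring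

/-- **LOCATED REMARK 2.**  The junction's θ-free count binder `hcount` — `2|Λ| + ½|Λ ⊕ C₀| + 2·K₀(64,8)·α₄·#⋃𝐃 ≤ a₅·|Z|` per term —
read at ONE term with non-empty 𝐃-support (`1 ≤ #⋃𝐃`): the record's activity letter is capped by the support ratio,
`2·K₀(64,8)·α₄·#⋃𝐃 ≤ a₅·|Z|`, i.e. `α₄ ≤ a₅·|Z| ∕ (2·K₀(64,8)·#⋃𝐃)` (with `a₅ < A_abs ≤ δ·ℓ·κ∕64` inside `Lemma3Numerics`).  Stated on
real letters `nΛ nΛC nD vol` for the four cardinalities. [cite: Balaban1988RG2Cluster, (2.24)-(2.26) p.17, p.20 (restrictions on the constants)] -/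
theorem alpha4_le_of_count {a₅ nΛ nΛC nD vol : ℝ} (hΛ : 0 ≤ nΛ) (hΛC : 0 ≤ nΛC) (hD : 1 ≤ nD)
    (hcount : 2 * nΛ + nΛC / 2 + 2 * (K₀ 64 8 * c.α₄ * nD) ≤ a₅ * vol) :
    2 * K₀ 64 8 * c.α₄ * nD ≤ a₅ * vol ∧ c.α₄ ≤ a₅ * vol / (2 * K₀ 64 8 * nD) := by
  have hK₀ : 0 < K₀ 64 8 := K₀_pos 64 8
  have h1 : 2 * K₀ 64 8 * c.α₄ * nD ≤ a₅ * vol := by nlinarith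
  refine ⟨h1, ?_⟩
  rw [le_div_iff₀ (by positivity)]
  nlinarith

end Located

/-! ## §2. The chain's `q = 8` record with the ACTIVITY DIAL `α₄` (and `ε₁ ∝ α₄`): the 69 conjuncts on the two-parameter family -/

/-- WITNESS DATA. n10-w1's `constsQ8 M` with the activity letter `α₄ := a` a DIAL and `ε₁ := a·(ε₁t·M⁻⁸·e^{−49κ₁t})` — print's order of
choices, p. 21: `α₄` after the in-edge prefactors, `ε₁` last, so that `ε₂ = 2E₀ε₁C₁α₄⁻¹α₆⁻¹M^q e^{C₂κ₁}`, `C₃ε₁` and `1∕|τ|` do not move.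
[cite: Balaban1988RG2Cluster, p.16 (after (2.18)), p.19 (definition of ε₂), p.21 (closing paragraph)] -/
def constsQ8A (M a : ℝ) : B13.Consts where
  L := 8
  q := 8
  M := M
  κ := κw
  κ₁ := κ₁t
  δ := δw
  δ₀ := 1
  E₀ := 2
  ε₁ := a * (ε₁t * (M ^ 8)⁻¹ * Real.exp (-(49 * κ₁t)))
  C₁ := 1
  C₂ := 50
  C₃ := 1
  α₀ := 1
  α₁ := 1
  α₄ := a
  α₅ := 1
  α₆ := α₆w
  γ₂ := 1
  γ := 1
  A₁ := A₁w
  A₂ := A₂w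

section Family

variable {M a : ℝ}

/-- The fields a consumer reads by name: `M`, `q = 8`, `L = 8`, `α₄ = a`, `κ₁ = κ₁t`, `δ₀ = 1`, `κ = κw`, `C₃ = 1`, `C₂ = 50`,
`ε₁ = a·(constsQ8 M).ε₁` (definitional). [cite: Balaban1988RG2Cluster, p.21 (closing paragraph)] -/
theorem constsQ8A_fields (M a : ℝ) :
    (constsQ8A M a).M = M ∧ (constsQ8A M a).q = 8 ∧ (constsQ8A M a).L = 8 ∧ (constsQ8A M a).α₄ = a ∧ (constsQ8A M a).κ₁ = κ₁t ∧
      (constsQ8A M a).δ₀ = 1 ∧ (constsQ8A M a).κ = κw ∧ (constsQ8A M a).C₃ = 1 ∧ (constsQ8A M a).C₂ = 50 ∧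
      (constsQ8A M a).ε₁ = a * (constsQ8 M).ε₁ :=
  ⟨rfl, rfl, rfl, rfl, rfl, rfl, rfl, rfl, rfl, rfl⟩

/-- `1 ≤ κ₁t` (indeed `κ₁t = 1 + 36·(19∕10)·κw` with `κw ≥ 1280`). [folklore] -/
private theorem one_le_κ₁t : 1 ≤ κ₁t ∧ 0 < κ₁t := by
  have hκ₁t : κ₁t = 1 + 36 * μw := rfl
  have hμ : μw = (1 - 7 * δw) * 4 * κw := rfl
  have hκw := κw_lower.2
  have hμ0 : 0 ≤ μw := by rw [hμ]; unfold δw; nlinarith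
  constructor <;> linarith

/-- `0 < ε₁t` (lit-balaban's witness letter; re-derived, the owner's is private). [folklore] -/
private theorem ε₁t_pos' : 0 < ε₁t := by
  have hKw : 0 < Kw := K₀_pos 64 8
  have hα₆ : 0 < α₆w := by unfold α₆w; positivity
  have hAup : 0 < Aup := by unfold Aup; positivity
  have hA₁ : 0 < A₁w := by unfold A₁w; positivity
  have hA₂ : 0 < A₂w := by unfold A₂w; positivity
  have hε₂ : 0 < ε₂w := by unfold ε₂w; positivity
  unfold ε₁t; positivity

/-- `0 < ε₁` on the family (`M > 0`, `a > 0`). [cite: Balaban1988RG2Cluster, p.21 (closing paragraph)] -/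
theorem constsQ8A_ε₁_pos (hM0 : 0 < M) (ha : 0 < a) : 0 < (constsQ8A M a).ε₁ := by
  show 0 < a * (ε₁t * (M ^ 8)⁻¹ * Real.exp (-(49 * κ₁t)))
  exact mul_pos ha (constsQ8_ε₁_pos hM0)

/-- INVARIANT PRODUCT 1: `ε₁·K₀` does not see the dial (`a·a⁻¹ = 1`). [cite: Balaban1988RG2Cluster, p.19 (definition of ε₂)] -/
theorem constsQ8A_ε₁K₀ (ha : a ≠ 0) : (constsQ8A M a).ε₁ * (constsQ8A M a).K₀ = (constsQ8 M).ε₁ * (constsQ8 M).K₀ := by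
  show a * (ε₁t * (M ^ 8)⁻¹ * Real.exp (-(49 * κ₁t))) * (2 * 1 * a⁻¹ * α₆w⁻¹ * M ^ 8 * Real.exp (50 * κ₁t)) =
    ε₁t * (M ^ 8)⁻¹ * Real.exp (-(49 * κ₁t)) * (2 * 1 * (1 : ℝ)⁻¹ * α₆w⁻¹ * M ^ 8 * Real.exp (50 * κ₁t))
  have h1 : a * a⁻¹ = 1 := mul_inv_cancel₀ ha
  calc a * (ε₁t * (M ^ 8)⁻¹ * Real.exp (-(49 * κ₁t))) * (2 * 1 * a⁻¹ * α₆w⁻¹ * M ^ 8 * Real.exp (50 * κ₁t))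
      = (a * a⁻¹) * (ε₁t * (M ^ 8)⁻¹ * Real.exp (-(49 * κ₁t)) * (2 * 1 * α₆w⁻¹ * M ^ 8 * Real.exp (50 * κ₁t))) := by ring
    _ = ε₁t * (M ^ 8)⁻¹ * Real.exp (-(49 * κ₁t)) * (2 * 1 * (1 : ℝ)⁻¹ * α₆w⁻¹ * M ^ 8 * Real.exp (50 * κ₁t)) := by
        rw [h1, inv_one]; ring

/-- INVARIANT PRODUCT 1′: `ε₂` does not see the dial. [cite: Balaban1988RG2Cluster, p.19 (definition of ε₂)] -/
theorem constsQ8A_eps2 (ha : a ≠ 0) : (constsQ8A M a).eps2 = (constsQ8 M).eps2 := by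
  show (constsQ8A M a).E₀ * (constsQ8A M a).ε₁ * (constsQ8A M a).K₀ = (constsQ8 M).E₀ * (constsQ8 M).ε₁ * (constsQ8 M).K₀
  rw [mul_assoc, constsQ8A_ε₁K₀ ha, ← mul_assoc]
  rfl

/-- INVARIANT PRODUCT 2: `C₃·ε₁` (the activity constant times `ε₁`) does not see the dial. [cite: Balaban1988RG2Cluster, p.20 (definition of C₃)] -/
theorem constsQ8A_C3act_ε₁ (ha : a ≠ 0) : (constsQ8A M a).C3act * (constsQ8A M a).ε₁ = (constsQ8 M).C3act * (constsQ8 M).ε₁ := by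
  show 2 * (((constsQ8A M a).L : ℝ) + 2) ^ 4 * (constsQ8A M a).A₁ * ((constsQ8A M a).E₀ * (constsQ8A M a).K₀) * (constsQ8A M a).ε₁ =
    2 * (((constsQ8 M).L : ℝ) + 2) ^ 4 * (constsQ8 M).A₁ * ((constsQ8 M).E₀ * (constsQ8 M).K₀) * (constsQ8 M).ε₁
  calc 2 * (((constsQ8A M a).L : ℝ) + 2) ^ 4 * (constsQ8A M a).A₁ * ((constsQ8A M a).E₀ * (constsQ8A M a).K₀) * (constsQ8A M a).ε₁
      = 2 * (((constsQ8A M a).L : ℝ) + 2) ^ 4 * (constsQ8A M a).A₁ * (constsQ8A M a).E₀ * ((constsQ8A M a).ε₁ * (constsQ8A M a).K₀) := by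
        ring
    _ = 2 * (((constsQ8 M).L : ℝ) + 2) ^ 4 * (constsQ8 M).A₁ * (constsQ8 M).E₀ * ((constsQ8 M).ε₁ * (constsQ8 M).K₀) := by
        rw [constsQ8A_ε₁K₀ ha]; rfl
    _ = _ := by ring

/-- INVARIANT PRODUCT 3: `1∕|τ|` (the (2.18) prefactor at every tree distance) does not see the dial. [cite: Balaban1988RG2Cluster, (2.18) p.16] -/
theorem constsQ8A_invTau (ha : a ≠ 0) (d : ℝ) : invTau (constsQ8A M a) d = invTau (constsQ8 M) d := by
  show 2 * (a * (ε₁t * (M ^ 8)⁻¹ * Real.exp (-(49 * κ₁t)))) * 1 * a⁻¹ * M ^ 8 * Real.exp (50 * κ₁t) *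
      Real.exp (-(1 - 3 * δw) * κw * d) =
    2 * (ε₁t * (M ^ 8)⁻¹ * Real.exp (-(49 * κ₁t))) * 1 * (1 : ℝ)⁻¹ * M ^ 8 * Real.exp (50 * κ₁t) *
      Real.exp (-(1 - 3 * δw) * κw * d)
  have h1 : a * a⁻¹ = 1 := mul_inv_cancel₀ ha
  calc 2 * (a * (ε₁t * (M ^ 8)⁻¹ * Real.exp (-(49 * κ₁t)))) * 1 * a⁻¹ * M ^ 8 * Real.exp (50 * κ₁t) *
        Real.exp (-(1 - 3 * δw) * κw * d)
      = (a * a⁻¹) * (2 * (ε₁t * (M ^ 8)⁻¹ * Real.exp (-(49 * κ₁t))) * 1 * M ^ 8 * Real.exp (50 * κ₁t) *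
          Real.exp (-(1 - 3 * δw) * κw * d)) := by ring
    _ = _ := by rw [h1, inv_one]; ring

/-- The DIAL'S EFFECT: the (1.36) prefactor `E₀ε₁C₁M^q e^{C₂κ₁}` of the family is `2a·ε₁t·e^{κ₁t}` — linear in the activity dial
(`M ≠ 0`). [cite: Balaban1988RG2Cluster, (1.36) p.9, p.21 (closing paragraph)] -/
theorem constsQ8A_EM (hM0 : M ≠ 0) :
    (constsQ8A M a).E₀ * (constsQ8A M a).ε₁ * (constsQ8A M a).C₁ * (constsQ8A M a).M ^ (constsQ8A M a).q *
        Real.exp ((constsQ8A M a).C₂ * (constsQ8A M a).κ₁) = 2 * a * ε₁t * Real.exp κ₁t := by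
  show 2 * (a * (ε₁t * (M ^ 8)⁻¹ * Real.exp (-(49 * κ₁t)))) * 1 * M ^ 8 * Real.exp (50 * κ₁t) = 2 * a * ε₁t * Real.exp κ₁t
  have h8 : (M ^ 8)⁻¹ * M ^ 8 = 1 := inv_mul_cancel₀ (pow_ne_zero 8 hM0)
  have he : Real.exp (-(49 * κ₁t)) * Real.exp (50 * κ₁t) = Real.exp κ₁t := by
    rw [← Real.exp_add]; congr 1; ring
  calc 2 * (a * (ε₁t * (M ^ 8)⁻¹ * Real.exp (-(49 * κ₁t)))) * 1 * M ^ 8 * Real.exp (50 * κ₁t)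
      = 2 * a * ε₁t * (((M ^ 8)⁻¹ * M ^ 8) * (Real.exp (-(49 * κ₁t)) * Real.exp (50 * κ₁t))) := by ring
    _ = 2 * a * ε₁t * Real.exp κ₁t := by rw [h8, he, one_mul]

/-- **THE 69 CONJUNCTS OF THE CHAIN ON THE TWO-PARAMETER FAMILY** (the statement of `B13ChainJointNonvacuity226.constsQ8_spec` VERBATIM at
`c := constsQ8A M a`, every `M ≥ κw + 1`, every `a > 0`): (A) the bridge ∕ producer numbers (print's `q = 8`, R12), (B) the 16 Lemma-1 ∕ leaf
thresholds, (C) the 41 Lemma-3 conjuncts.  Transferred from `constsQ8_spec` BY NAME: the fields other than `ε₁, α₄` are the same literals; `ε₁,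
α₄` enter (A)–(C) only through signs and the three invariant products. [cite: Balaban1988RG2Cluster, p.16 (after (2.18)) and p.21 (closing paragraph)] -/
theorem constsQ8A_spec (hM : κw + 1 ≤ M) (ha : 0 < a) :
    -- (A) the bridge / producer numbers
    ((constsQ8A M a).q = 8 ∧ R12 (constsQ8A M a) ∧ 11 / 3 ≤ (constsQ8A M a).κ₁ ∧ 1 + 4 * Real.log 162 ≤ (constsQ8A M a).κ₁ ∧
      64 * Real.log 162 ≤ (constsQ8A M a).δ * (constsQ8A M a).κ ∧ 1 ≤ (constsQ8A M a).M ∧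
      0 < (constsQ8A M a).E₀ ∧ 0 < (constsQ8A M a).ε₁ ∧ 0 < (constsQ8A M a).C₁ ∧ 0 < (constsQ8A M a).α₄ ∧ 0 ≤ (constsQ8A M a).C₃ ∧
      27 * 1 * (constsQ8A M a).C₁ ^ 3 * Real.exp (49 * (constsQ8A M a).κ₁ - 1) ≤
        (constsQ8A M a).C₃ * Real.exp ((constsQ8A M a).C₂ * (constsQ8A M a).κ₁)) ∧
    -- (B) the Lemma-1 / leaf thresholds
    ((constsQ8A M a).L = 8 ∧ 12 ≤ (constsQ8A M a).L * 2 ∧ kappa₀ 64 8 ≤ (constsQ8A M a).κ ∧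
      kappa₀ 64 8 ≤ (constsQ8A M a).δ * (constsQ8A M a).κ ∧
      0 ≤ (constsQ8A M a).κ ∧ (constsQ8A M a).δ < 1 ∧ 1 ≤ (constsQ8A M a).δ * (constsQ8A M a).κ ∧
      1 + 2 * Real.log (8 * 12 ^ 3) ≤ (constsQ8A M a).κ₁ ∧ 2 + 16 * Real.log 128 ≤ (constsQ8A M a).κ₁ ∧
      10 * Real.exp (-1) ≤ (constsQ8A M a).δ₀ * (constsQ8A M a).M ∧ 2 * Real.log 5 ≤ (constsQ8A M a).δ₀ * (constsQ8A M a).M ∧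
      (1 - (constsQ8A M a).δ) * (constsQ8A M a).κ ≤ (1 / 4) * ((constsQ8A M a).κ₁ - 1) ∧
      (1 - 2 * (constsQ8A M a).δ) * (constsQ8A M a).κ ≤ (1 / 16) * (constsQ8A M a).κ₁ ∧
      0 < (constsQ8A M a).E₀ * (constsQ8A M a).ε₁ * (constsQ8A M a).C₁ * (constsQ8A M a).M ^ (constsQ8A M a).q *
        Real.exp ((constsQ8A M a).C₂ * (constsQ8A M a).κ₁) ∧ 0 ≤ (constsQ8A M a).ε₁ ∧ 0 ≤ (constsQ8A M a).C₃) ∧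
    -- (C) the 41 Lemma-3 conjuncts
    (8 ≤ (constsQ8A M a).L ∧ 0 < (1 : ℕ) ∧ 0 < (constsQ8A M a).ε₁ ∧ 0 < (constsQ8A M a).α₆ ∧ 0 ≤ (constsQ8A M a).eps2 ∧
      0 ≤ (constsQ8A M a).δ ∧
      0 ≤ 1 - 7 * (constsQ8A M a).δ ∧ 0 ≤ (constsQ8A M a).κ ∧ 0 ≤ aw ∧
      (constsQ8A M a).R15 ∧ 18 * ((1 - 4 * (constsQ8A M a).δ) * (constsQ8A M a).κ) ≤ aw / 20 ∧ 4 * (constsQ8A M a).κ ≤ aw / 20 ∧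
      Real.exp (-(aw / 20)) ≤ (constsQ8A M a).eps2 ∧
      2 * (4 : ℝ) * ((1 : ℕ) : ℝ) ^ 4 * Real.exp (-(aw / 10)) ≤ aw / 20 ∧
      0 ≤ (1 : ℝ) ∧ kappa₀ 64 8 + 1 ≤ (constsQ8A M a).δ * (constsQ8A M a).κ ∧
      (constsQ8A M a).α₆ * Real.exp 1 * K₀ 64 8 * 64 ≤ 1 ∧
      Real.exp (-(aw / 20)) * 64 ≤ (constsQ8A M a).δ * (constsQ8A M a).κ ∧
      B13Step237.R18half (constsQ8A M a) (K₀ 64 8 * Real.exp (Real.exp (-(aw / 20)) * 64)) ∧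
      B13Step237.R18sharp (constsQ8A M a) (K₀ 64 8 * Real.exp (Real.exp (-(aw / 20)) * 64)) (((constsQ8A M a).L : ℝ) / 2) ∧
      0 ≤ (1 : ℝ) ∧ kappa₀ 64 8 + 1 ≤ (constsQ8A M a).δ * (((constsQ8A M a).L : ℝ) / 2) * (constsQ8A M a).κ ∧
      (constsQ8A M a).α₆ * Real.exp 1 * K₀ 64 8 * 64 ≤ 1 ∧
      18 * ((1 - 7 * (constsQ8A M a).δ) * (((constsQ8A M a).L : ℝ) / 2) * (constsQ8A M a).κ) ≤ ((constsQ8A M a).κ₁ - 1) / 2 ∧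
      (0 : ℝ) ≤ 1 / 2 ∧ 1 / 2 + Real.exp (-(((constsQ8A M a).κ₁ - 1) / 2)) ≤ 1 ∧
      1 * 64 ≤ (constsQ8A M a).δ * (((constsQ8A M a).L : ℝ) / 2) * (constsQ8A M a).κ ∧
      B13Step237.bracketF (constsQ8A M a) (K₀ 64 8 * Real.exp (Real.exp (-(aw / 20)) * 64)) / (constsQ8A M a).α₆ * Real.exp (1 * 64) ≤
        (constsQ8A M a).C3act * (constsQ8A M a).ε₁ ∧
      0 ≤ (constsQ8A M a).C3act * (constsQ8A M a).ε₁ ∧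
      (constsQ8A M a).κ + 2 * (64 * Real.log 162) + 2 ≤ (1 - 8 * (constsQ8A M a).δ) * (((constsQ8A M a).L : ℝ) / 2) * (constsQ8A M a).κ ∧
      (constsQ8A M a).C3act * (constsQ8A M a).ε₁ * Real.exp (5 * (constsQ8A M a).κ + 1) * K₀ 64 8 * 9 * 64 ≤ 1 ∧
      Real.exp 1 * 9 * 64 * K₀ 64 8 ^ 2 ≤ (constsQ8A M a).A₂ ∧ (constsQ8A M a).R22 ∧ (constsQ8A M a).R23 ∧ (constsQ8A M a).R24sharp ∧
      0 ≤ (constsQ8A M a).E₀ ∧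
      0 ≤ (1 / 64 : ℝ) ∧ 1 / 64 * 64 ≤ (constsQ8A M a).E₀ / 2 ∧
      (0 : ℝ) < 1 / 2 ∧ 1 ≤ (constsQ8A M a).κ₁ ∧
      (∀ d : ℝ, 0 ≤ d → 0 < invTau (constsQ8A M a) d ∧ invTau (constsQ8A M a) d ≤ 1 / 2)) := by
  have hM0 : 0 < M := by linarith [κw_lower.1]
  have ha0 : a ≠ 0 := ha.ne'
  have hε₁ : 0 < (constsQ8A M a).ε₁ := constsQ8A_ε₁_pos hM0 ha
  have hE := constsQ8A_eps2 (M := M) ha0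
  have hCE := constsQ8A_C3act_ε₁ (M := M) ha0
  have hI := constsQ8A_invTau (M := M) ha0
  have hmem : ∀ A : ℝ, B13Step237.memberF (constsQ8A M a) A = B13Step237.memberF (constsQ8 M) A := by
    intro A
    show (((constsQ8A M a).L : ℝ) + 2) ^ 4 * A * (constsQ8A M a).eps2 = (((constsQ8 M).L : ℝ) + 2) ^ 4 * A * (constsQ8 M).eps2
    rw [hE]
    rfl
  have hbr : ∀ A : ℝ, B13Step237.bracketF (constsQ8A M a) A = B13Step237.bracketF (constsQ8 M) A := by
    intro A
    show 2 * B13Step237.memberF (constsQ8A M a) A = 2 * B13Step237.memberF (constsQ8 M) A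
    rw [hmem]
  -- the source bundle: n10-w1's 69 conjuncts at `constsQ8 M`
  obtain ⟨⟨-, a2, a3, a4, a5, a6, a7, -, a9, -, a11, a12⟩,
    ⟨b1, b2, b3, b4, b5, b6, b7, b8, b9, b10, b11, b12, b13, -, -, b16⟩,
    ⟨n1, n2, -, n4, n5, n6, n7, n8, n9, n10, n11, n12, n13, n14, n15, n16, n17, n18, n19, n20, n21, n22, n23, n24,
      n25, n26, n27, n28, n29, n30, n31, n32, n33, n34, n35, n36, n37, n38, n39, n40, n41⟩⟩ := constsQ8_spec hM
  refine ⟨?_, ?_, ?_⟩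
  · -- (A): `R12` reads `δ κ κ₁ C₃ E₀ C₁ q` only; signs of `ε₁ α₄` are the dial's
    refine ⟨rfl, ?_, a3, a4, a5, a6, a7, hε₁, a9, ha, a11, a12⟩
    unfold R12 at a2 ⊢
    exact a2
  · -- (B): the thirteen thresholds and the two `δ₀M` floors are `constsQ8 M`'s own; the (1.36)-product is positive
    refine ⟨b1, b2, b3, b4, b5, b6, b7, b8, b9, b10, b11, b12, b13, ?_, hε₁.le, b16⟩
    show (0 : ℝ) < 2 * (a * (ε₁t * (M ^ 8)⁻¹ * Real.exp (-(49 * κ₁t)))) * 1 * M ^ 8 * Real.exp (50 * κ₁t)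
    have : 0 < a * (ε₁t * (M ^ 8)⁻¹ * Real.exp (-(49 * κ₁t))) := hε₁
    positivity
  · -- (C): the 41 conjuncts transfer through the invariant products
    refine ⟨n1, n2, hε₁, n4, ?_, n6, n7, n8, n9, ?_, n11, n12, ?_, n14, n15, n16, n17, n18, ?_, ?_, n21, n22, n23,
      n24, n25, n26, n27, ?_, ?_, n30, ?_, n32, ?_, ?_, n35, n36, n37, n38, n39, n40, ?_⟩
    · rw [hE]; exact n5
    · show (constsQ8A M a).eps2 * Real.exp (5 * (constsQ8A M a).κ) ≤ 1
      rw [hE]; exact n10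
    · rw [hE]; exact n13
    · show B13Step237.memberF (constsQ8A M a) _ ≤ 1 / 2
      rw [hmem]; exact n19
    · show B13Step237.bracketF (constsQ8A M a) _ * Real.exp (5 * ((1 - 7 * (constsQ8A M a).δ) * _ * (constsQ8A M a).κ)) ≤ (constsQ8A M a).α₆
      rw [hbr]; exact n20
    · rw [hbr, hCE]; exact n28
    · rw [hCE]; exact n29
    · rw [hCE]; exact n31
    · show (1 - 10 * (constsQ8A M a).δ) * (((constsQ8A M a).L : ℝ) / 2) = 1
      exact n33
    · show (constsQ8A M a).A₂ * (constsQ8A M a).C3act * (constsQ8A M a).ε₁ ≤ (constsQ8A M a).E₀ / 2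
      rw [mul_assoc, hCE, ← mul_assoc]; exact n34
    · intro d hd
      rw [hI d]
      exact n41 d hd

/-- **The junction's `hN` shape on the family**: `Lemma3Numerics (constsQ8A M a) 1 (L∕2) aw 1 1 ½ 1`, packaged from (C) exactly as
`constsQ8_numerics`. [cite: Balaban1988RG2Cluster, pp.17–20 (restrictions on the constants), p.21 (closing paragraph)] -/
theorem constsQ8A_numerics (hM : κw + 1 ≤ M) (ha : 0 < a) :
    Lemma3Numerics (constsQ8A M a) 1 (((constsQ8A M a).L : ℝ) / 2) aw 1 1 (1 / 2) 1 := by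
  obtain ⟨-, -, ⟨-, -, -, hα₆, heps2, hδ, hδ7, hκ, ha', hR15, hR16, hR16', hR17, h231, ha₂, hκ229, hsm229, habsk, h18half, h18,
    ha₂', hκ229', hsm229', hR20, ha₅, habs, hAc, hC3, -⟩⟩ := constsQ8A_spec hM ha
  have hℓ : (0 : ℝ) ≤ ((constsQ8A M a).L : ℝ) / 2 := by positivity
  exact ⟨hℓ, hα₆, heps2, hδ, hδ7, hκ, ha', hR15, hR16, hR16', hR17, h231, ha₂, hκ229, hsm229, habsk, h18half, h18, ha₂', hκ229',
    hsm229', hR20, ha₅, habs, hAc, hC3⟩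

/-- **The junction's `hτ2` shape on the family**: `E₀ε₁C₁α₄⁻¹M^q e^{C₂κ₁} ≤ ½` — invariant under the dial, so it is `constsQ8_invTau_zero`.
[cite: Balaban1988RG2Cluster, (2.18) p.16] -/
theorem constsQ8A_invTau_zero (hM : κw + 1 ≤ M) (ha : 0 < a) :
    (constsQ8A M a).E₀ * (constsQ8A M a).ε₁ * (constsQ8A M a).C₁ * (constsQ8A M a).α₄⁻¹ * (constsQ8A M a).M ^ (constsQ8A M a).q *
        Real.exp ((constsQ8A M a).C₂ * (constsQ8A M a).κ₁) ≤ 1 / 2 := by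
  have h := (((constsQ8A_spec hM ha).2.2).2.2.2.2.2.2.2.2.2.2.2.2.2.2.2.2.2.2.2.2.2.2.2.2.2.2.2.2.2.2.2.2.2.2.2.2.2.2.2.2 0 le_rfl).2
  unfold invTau at h
  simpa only [mul_zero, Real.exp_zero, mul_one] using h

/-- ★ **The (1.36) constant inequality `hC` WITH GIVEN PREFACTORS on the family**: at `θ₁ = ½` and the dial
`a := (lhs + 1)∕(ε₁t·e^{κ₁t})` (any larger works), `K·K₀(64,8)·2(6L)⁴·e·e^{κ₁(12⁴−1)∕8} + 2·64K′·K₀(64,8)·1344 ≤ (1 − ½)·E₀ε₁C₁M^q e^{C₂κ₁}`,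
for ANY real `K, K′` (`M ≠ 0`; `L = 8`, `κ₁ = κ₁t` are the record's). [cite: Balaban1988RG2Cluster, (1.36) p.9, p.21 (closing paragraph)] -/
theorem constsQ8A_hC {K K' : ℝ} (hM0 : M ≠ 0)
    (ha : (K * K₀ 64 8 * (2 * (6 * ((8 : ℕ) : ℝ)) ^ 4) * Real.exp 1 * Real.exp ((1 / 8) * κ₁t * (12 ^ 4 - 1)) +
        2 * (64 * K') * K₀ 64 8 * 1344 + 1) / (ε₁t * Real.exp κ₁t) ≤ a) :
    K * K₀ 64 8 * (2 * (6 * (((constsQ8A M a).L : ℕ) : ℝ)) ^ 4) * Real.exp 1 * Real.exp ((1 / 8) * (constsQ8A M a).κ₁ * (12 ^ 4 - 1)) +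
        2 * (64 * K') * K₀ 64 8 * 1344 ≤
      (1 - 1 / 2) * ((constsQ8A M a).E₀ * (constsQ8A M a).ε₁ * (constsQ8A M a).C₁ * (constsQ8A M a).M ^ (constsQ8A M a).q *
        Real.exp ((constsQ8A M a).C₂ * (constsQ8A M a).κ₁)) := by
  rw [constsQ8A_EM hM0]
  show K * K₀ 64 8 * (2 * (6 * ((8 : ℕ) : ℝ)) ^ 4) * Real.exp 1 * Real.exp ((1 / 8) * κ₁t * (12 ^ 4 - 1)) +
        2 * (64 * K') * K₀ 64 8 * 1344 ≤ (1 - 1 / 2) * (2 * a * ε₁t * Real.exp κ₁t)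
  have hε₁t : 0 < ε₁t := ε₁t_pos'
  have hden : 0 < ε₁t * Real.exp κ₁t := mul_pos hε₁t (Real.exp_pos _)
  have h := (div_le_iff₀ hden).1 ha
  nlinarith [h, hden]

/-- ★ **The Lemma-2 floor `hfloor` WITH GIVEN `K₂, m₂` on the family**: `27·m₂·K₂·e^{κ₁−1} ≤ C₃·M⁴·e^{C₂κ₁}` whenever `27m₂K₂ ≤ M`, `1 ≤ M`
(`C₃ = 1`, `C₂ = 50`, `κ₁ = κ₁t ≥ 1`). [cite: Balaban1988RG2Cluster, (1.38)–(1.39) p.10, (1.43) p.11, p.21 (closing paragraph)] -/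
theorem constsQ8A_hfloor {K₂ : ℝ} {m₂ : ℕ} (hK₂ : 0 ≤ K₂) (hM1 : 1 ≤ M) (hMK : 27 * (m₂ : ℝ) * K₂ ≤ M) :
    27 * m₂ * K₂ * Real.exp ((constsQ8A M a).κ₁ - 1) ≤ (constsQ8A M a).C₃ * (constsQ8A M a).M ^ 4 * Real.exp ((constsQ8A M a).C₂ * (constsQ8A M a).κ₁) := by
  show 27 * (m₂ : ℝ) * K₂ * Real.exp (κ₁t - 1) ≤ 1 * M ^ 4 * Real.exp (50 * κ₁t)
  have hκ := one_le_κ₁t.1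
  have hexp : Real.exp (κ₁t - 1) ≤ Real.exp (50 * κ₁t) := Real.exp_le_exp.2 (by linarith)
  have hM4 : M ≤ M ^ 4 := by
    calc M = M ^ 1 := (pow_one M).symm
      _ ≤ M ^ 4 := pow_le_pow_right₀ hM1 (by norm_num)
  have h27 : 0 ≤ 27 * (m₂ : ℝ) * K₂ := by positivity
  calc 27 * (m₂ : ℝ) * K₂ * Real.exp (κ₁t - 1) ≤ M ^ 4 * Real.exp (50 * κ₁t) :=
        mul_le_mul (hMK.trans hM4) hexp (Real.exp_pos _).le (by positivity)
    _ = 1 * M ^ 4 * Real.exp (50 * κ₁t) := by ring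

end Family

/-! ## §3. ONE reference package: unit rates, `m₀ = 2`, `m_{A,0} = 1`, all expansion constants `:= F`, `n_B = 1`, `d_m = ν` -/

/-- WITNESS DATA. The reference package of the joint witness: analyticity radius `R = 1`, unit input rates `ε_L = κ_L = ε_P = κ_P = ε_A =
κ_A = 1`, accretivity constants `m₀ = 2`, `m_{A,0} = 1`, expansion constants `K̄_L = K̄_P = K̄_A := F` (the junction's floor), volume rate `η`,
far-ness `R_σ`, `n_B = 1`, `d_m = ν` — the last two parameters are filled in two passes (`η := etaMax`, then `R_σ := rsigmaMin`), which is
legitimate because `etaMax` does not read `η` and no derived letter reads `R_σ`. [cite: Balaban1988RG2Cluster, p.13, p.15, (2.16) p.16] -/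
def refPackageJoint (ν : ℕ) (F η Rσ : ℝ) : RefPackage where
  R := 1
  εL := 1
  kapL := 1
  KbarL := F
  εP := 1
  kapP := 1
  KbarP := F
  m₀ := 2
  εA := 1
  kapA := 1
  KbarA := F
  mA₀ := 1
  η := η
  Rσ := Rσ
  nB := 1
  dm := ν

section Package

variable {ν : ℕ} {F η Rσ : ℝ}

/-- The package is admissible for `F ≥ 0` and `0 < η ≤ 1` (`η ≤ κ_A = 1`). [cite: Balaban1988RG2Cluster, p.15, (2.16) p.16] -/
theorem refPackageJoint_admissible (hF : 0 ≤ F) (hη : 0 < η) (hη1 : η ≤ 1) : (refPackageJoint ν F η Rσ).Admissible where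
  hR := one_pos
  hεL := zero_le_one
  hkapL := zero_le_one
  hKbarL := hF
  hεP := zero_le_one
  hkapP := one_pos
  hKbarP := hF
  hm₀ := two_pos
  hεA := zero_le_one
  hkapA := one_pos
  hKbarA := hF
  hmA₀ := one_pos
  hη := hη
  hηA := hη1

/-- Its W-walks package has strictly positive input rates, on every radius. [cite: Balaban1985BackgroundPropagators, Thm 3.10 p.416] -/
theorem positiveRates_refPackageJoint (R₁ : ℝ) : ((refPackageJoint ν F η Rσ).toWalkPackage R₁).PositiveRates :=
  ⟨one_pos, one_pos, one_pos, one_pos, one_pos⟩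

/-- The admissible ceiling `etaMax` of the W-walks package is `η`-, `R_σ`- and `R₁`-FREE (`rfl`): it reads
`κ_P, m₀, K̄_P, c_V₀(κ_P, n_B, d_m), ε_P, κ_L, ε_L, κ_A, ε_A` only. [cite: Balaban1988RG2Cluster, (2.16) p.16] -/
theorem etaMax_refPackageJoint_eq (R₁ : ℝ) :
    ((refPackageJoint ν F η Rσ).toWalkPackage R₁).etaMax = ((refPackageJoint ν F 1 0).toWalkPackage 1).etaMax := rfl

/-- `0 < etaMax ≤ ½ ≤ 1` for the package (`F ≥ 0`): `etaMax = min(μ∕4, ρ_E∕2)` with `μ > 0` (admissible, positive rates) and `ρ_E = 1`.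
[cite: Balaban1988RG2Cluster, (2.16) p.16] -/
theorem etaMax_refPackageJoint_pos_le (hF : 0 ≤ F) :
    0 < ((refPackageJoint ν F 1 0).toWalkPackage 1).etaMax ∧ ((refPackageJoint ν F 1 0).toWalkPackage 1).etaMax ≤ 1 := by
  have hr : (refPackageJoint ν F 1 0).Admissible := refPackageJoint_admissible hF one_pos le_rfl
  have hq := admissible_toWalkPackage hr one_pos
  have hp := positiveRates_refPackageJoint (ν := ν) (F := F) (η := 1) (Rσ := 0) 1
  have hμ := mu_pos hq hp
  have hρ := rhoE_pos hp
  have hρ1 : ((refPackageJoint ν F 1 0).toWalkPackage 1).rhoE = 1 := by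
    show min (1 : ℝ) 1 = 1
    exact min_self 1
  constructor
  · show 0 < min (((refPackageJoint ν F 1 0).toWalkPackage 1).mu / 4) (((refPackageJoint ν F 1 0).toWalkPackage 1).rhoE / 2)
    exact lt_min (by linarith) (by linarith)
  · show min (((refPackageJoint ν F 1 0).toWalkPackage 1).mu / 4) (((refPackageJoint ν F 1 0).toWalkPackage 1).rhoE / 2) ≤ 1
    rw [hρ1]
    exact (min_le_right _ _).trans (by norm_num)

end Package

/-! ## §4. THE JOINT WITNESS: prefactors given, ONE record, ONE `cp`, ONE admissible reference package -/

/-- ★★★ **JOINT NON-VACUITY OF THE N10 JUNCTION'S NUMERICAL BINDERS — PREFACTORS GIVEN, ONE RECORD, ONE REFERENCE PACKAGE.**  For EVERY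
positive prefactor triple `K K′ K₂` of (1.24) ∕ (1.30) ∕ (1.38) and every multiplicity `m₂`, and EVERY choice of NODE A's location ∕ entry
letters `m ν m′ mF c₀ rC` and `BΔ ≥ 0`, there are ONE constants record `c` (a member `constsQ8A M α₄` of §2's family, `M ≥ κw + 1`, `α₄ > 0` — so
the chain's 69 conjuncts hold at it, `constsQ8A_spec`), ONE `cp` (`κ₁ ↦ κ₁ + 1`), ONE admissible `rf : RefPackage` and reals `R₁ θ₀ α θ₁ R r γ₂
r_P ρΔ ηΔ μΔ M₁` meeting SIMULTANEOUSLY, in the SHAPES of the junction of record (67 ∕ 67R ∕ 67RD): (1) `hN` (`Lemma3Numerics c 1 (L∕2) aw 1 1 ½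
1`), `hτ2`, `h12`, `hL8`, `hE hε hC₁ hα hM`; (2) the Lemma 1–2 located NUMERICAL inputs WITH THE GIVEN PREFACTORS — `hK hK′ hθ₁0 hθ₁1`, `hC`,
`hK₂ hR hε3 hfloor`, `hκp`, `hr hr1`; (3) the rung — `hrf`, `hR₁def`, `hp`, `hη`, `hθ₀def` (at rf's DERIVED letters), `0 < θ₀`, `hαnn` (indeed
`0 < α`), `hαloc`, `hRσloc`, `hKdim hεL hκL hKL hεA hκA hKA hmA`; (4) NODE A's `hηΔ hP2 hμΔ hbudget hkbar` at `cp.κ₁`; (5) the (2.24)–(2.26)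
located numerals at rf's letters and the record's own `α₄ M κ₁` — `0 < γ₂ ≤ γ₂max`, `M⁴min ≤ c.M⁴` — and p. 17's `a ≤ γ₂·r_P²`.  Consistency
of typed inequality lists; nothing about Bałaban's constants; the junction's OBJECT binders are not touched.
[cite: Balaban1988RG2Cluster, Lemma 1 (1.36) p.9, Lemma 2 (1.43) p.11, p.13, p.15, (2.16)–(2.18) p.16, (2.22) p.16, (2.24)-(2.26) p.17, p.21 (closing paragraph); Balaban1987RG1, (1.11)–(1.14) p.262; Balaban1985BackgroundPropagators, Thm 3.10 p.416; Balaban1984PropagatorsII, Lemma 2.1 (2.61) p.234] -/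
theorem junction_numerals_joint_witness {K K' K₂ : ℝ} (hK : 0 < K) (hK' : 0 < K') (hK₂ : 0 < K₂) (m₂ : ℕ)
    (m ν m' mF c₀ : ℕ) (rC : ℝ) {BΔ : ℝ} (hB : 0 ≤ BΔ) :
    ∃ (c cp : B13.Consts) (rf : RefPackage) (R₁ θ₀ α θ₁ R r γ₂ rP ρΔ ηΔ μΔ M₁ : ℝ),
      -- (0) the record is a member of the two-parameter family: the chain's 69 conjuncts hold at it (`constsQ8A_spec`)
      (∃ M a : ℝ, κw + 1 ≤ M ∧ 0 < a ∧ c = constsQ8A M a) ∧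
      -- (1) the junction's `hN`, `hτ2`, `h12`, `hL8`, `hE hε hC₁ hα hM`
      (Lemma3Numerics c 1 ((c.L : ℝ) / 2) aw 1 1 (1 / 2) 1 ∧
        c.E₀ * c.ε₁ * c.C₁ * c.α₄⁻¹ * c.M ^ c.q * Real.exp (c.C₂ * c.κ₁) ≤ 1 / 2 ∧
        R12 c ∧ 8 ≤ c.L ∧ 0 < c.E₀ ∧ 0 < c.ε₁ ∧ 0 < c.C₁ ∧ 0 < c.α₄ ∧ 1 ≤ c.M) ∧
      -- (2) ★ the Lemma 1–2 located NUMERICAL inputs with the GIVEN prefactors: `hK hK' hθ₁0 hθ₁1 hC`, `hK₂ hR hε3 hfloor`, `hκp`, `hr hr1`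
      (0 ≤ K ∧ 0 ≤ K' ∧ 0 ≤ θ₁ ∧ θ₁ < 1 ∧
        K * K₀ 64 8 * (2 * (6 * ((c.L : ℕ) : ℝ)) ^ 4) * Real.exp 1 * Real.exp ((1 / 8) * c.κ₁ * (12 ^ 4 - 1)) +
            2 * (64 * K') * K₀ 64 8 * 1344 ≤
          (1 - θ₁) * (c.E₀ * c.ε₁ * c.C₁ * c.M ^ c.q * Real.exp (c.C₂ * c.κ₁))) ∧
      (0 ≤ K₂ ∧ 0 < R ∧ 3 * c.ε₁ ≤ R ∧ 27 * m₂ * K₂ * Real.exp (c.κ₁ - 1) ≤ c.C₃ * c.M ^ 4 * Real.exp (c.C₂ * c.κ₁)) ∧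
      c.κ₁ < cp.κ₁ ∧ (0 < r ∧ r ≤ 1) ∧
      -- (3) ★ the RUNG at ONE admissible reference package, dials located: `hrf hR₁def hp hη hθ₀def`, `0 < θ₀`, `0 < α`, `hαloc hRσloc`,
      --     `hKdim hεL hκL hKL hεA hκA hKA hmA`
      (rf.Admissible ∧ R₁ = radiusStar rf.R rf.m₀ rf.mA₀ rf.KbarP rf.KbarA rf.cV rf.cV₀ ∧
        (rf.toWalkPackage R₁).PositiveRates ∧ rf.η ≤ (rf.toWalkPackage R₁).etaMax ∧
        θ₀ = theta0Max m ν (rf.toWalkPackage R₁).kapCStar (rf.toWalkPackage R₁).Kbar (8 / rf.mA₀) (2 / rf.mA₀)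
          (rf.toWalkPackage R₁).BΓ rf.cV (B6.c0 1 rf.η) rf.mA₀ ∧ 0 < θ₀ ∧
        0 < α ∧ α ≤ alphaMax θ₀ R₁ (rf.toWalkPackage R₁).Kbar ∧
        rsigmaMin θ₀ (rf.toWalkPackage R₁).Kbar (rf.toWalkPackage R₁).mu (rf.toWalkPackage R₁).kapCStar rf.m₀ rf.mA₀ rf.KbarP rf.KbarA
          rf.cV rf.cV₀ rf.εP rf.εA ≤ rf.Rσ ∧
        ν ≤ rf.dm ∧ rf.εL ≤ rf.εP ∧ rf.kapL ≤ rf.kapP ∧ rf.KbarP ≤ rf.KbarL ∧ rf.εA ≤ rf.εP ∧ rf.kapA ≤ rf.kapP ∧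
        rf.KbarP ≤ rf.KbarA ∧ rf.mA₀ ≤ rf.m₀) ∧
      -- (4) ★ NODE A's rate budget and expansion-constant floor at `cp.κ₁`: `hηΔ hP2 hμΔ hbudget hkbar`
      (0 < ηΔ ∧ 2 * cp.κ₁ ≤ ηΔ * M₁ ∧ 0 < μΔ ∧ ηΔ + rf.εP + rf.kapP + 4 * μΔ ≤ ρΔ ∧
        kbarFloor ν mF c₀ ρΔ ηΔ μΔ rC cp.κ₁ BΔ ≤ rf.KbarP) ∧
      -- (5) the (2.24)–(2.26) located numerals at rf's letters and the record's own `α₄ M κ₁` (`hγ₂ hγle hM4`) + p. 17's `a ≤ γ₂ r_P²`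
      (0 < γ₂ ∧ γ₂ ≤ gamma2Max m ν (2 / rf.mA₀) (rf.toWalkPackage R₁).BΓ rf.cV (B6.c0 1 rf.η) rf.mA₀ ∧
        m4Min m ν m' (2 / rf.mA₀) (rf.toWalkPackage R₁).BΓ rf.cV (B6.c0 1 rf.η) rf.mA₀ c.α₄ c.κ₁ ≤ c.M ^ 4 ∧
        0 < rP ∧ aw ≤ γ₂ * rP ^ 2) := by
  -- ORDER OF CHOICE (p. 21). (i) the activity dial from the prefactors
  let lhs : ℝ := K * K₀ 64 8 * (2 * (6 * ((8 : ℕ) : ℝ)) ^ 4) * Real.exp 1 * Real.exp ((1 / 8) * κ₁t * (12 ^ 4 - 1)) +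
    2 * (64 * K') * K₀ 64 8 * 1344
  have hε₁t : 0 < ε₁t := ε₁t_pos'
  have hden : 0 < ε₁t * Real.exp κ₁t := mul_pos hε₁t (Real.exp_pos _)
  have hK₀ : 0 < K₀ 64 8 := K₀_pos 64 8
  have hlhs : 0 ≤ lhs := by positivity
  let a : ℝ := (lhs + 1) / (ε₁t * Real.exp κ₁t)
  have ha : 0 < a := div_pos (by linarith) hden
  -- (ii) `cp.κ₁ := κ₁t + 1`, NODE A's rates, the expansion-constant floor `F`
  have hκ₁ := one_le_κ₁t
  let ηΔ : ℝ := 2 * (κ₁t + 1)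
  let ρΔ : ℝ := ηΔ + 1 + 1 + 4 * 1
  let F : ℝ := kbarFloor ν mF c₀ ρΔ ηΔ 1 rC (κ₁t + 1) BΔ
  have hF : 0 ≤ F := kbarFloor_nonneg hB
  -- (iii) the package: `η := etaMax` (η-free), then `θ₀`, `R_σ := rsigmaMin` (R_σ-free letters)
  let η₀ : ℝ := ((refPackageJoint ν F 1 0).toWalkPackage 1).etaMax
  obtain ⟨hη₀, hη₀1⟩ : 0 < η₀ ∧ η₀ ≤ 1 := etaMax_refPackageJoint_pos_le hF
  let r₁ : RefPackage := refPackageJoint ν F η₀ 0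
  let R₁ : ℝ := radiusStar r₁.R r₁.m₀ r₁.mA₀ r₁.KbarP r₁.KbarA r₁.cV r₁.cV₀
  let q₁ : WalkPackage := r₁.toWalkPackage R₁
  let θ₀ : ℝ := theta0Max m ν q₁.kapCStar q₁.Kbar (8 / r₁.mA₀) (2 / r₁.mA₀) q₁.BΓ r₁.cV (B6.c0 1 r₁.η) r₁.mA₀
  let Rσ : ℝ := rsigmaMin θ₀ q₁.Kbar q₁.mu q₁.kapCStar r₁.m₀ r₁.mA₀ r₁.KbarP r₁.KbarA r₁.cV r₁.cV₀ r₁.εP r₁.εA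
  let rf : RefPackage := refPackageJoint ν F η₀ Rσ
  have hr₁ : r₁.Admissible := refPackageJoint_admissible hF hη₀ hη₀1
  have hrf : rf.Admissible := refPackageJoint_admissible hF hη₀ hη₀1
  have hR₁ : 0 < R₁ := radiusStar_pos hr₁.hR hr₁.hm₀ hr₁.hmA₀ hr₁.hKbarP hr₁.hKbarA (cV_nonneg hr₁) (cV₀_nonneg hr₁)
  have hq₁ : q₁.Admissible := admissible_toWalkPackage hr₁ hR₁
  have hp₁ : q₁.PositiveRates := positiveRates_refPackageJoint R₁
  have hκC : 0 < q₁.kapCStar := (kapCStar_spec hq₁ (rhoE_pos hp₁) (mu_pos hq₁ hp₁)).1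
  have hKbar : 0 ≤ q₁.Kbar := Kbar_nonneg hq₁
  have hmA : (0 : ℝ) < r₁.mA₀ := hr₁.hmA₀
  have hcE : (0 : ℝ) ≤ 2 / r₁.mA₀ := div_nonneg (by norm_num) hmA.le
  have hKCs : (0 : ℝ) ≤ 8 / r₁.mA₀ := div_nonneg (by norm_num) hmA.le
  have hcV : 0 ≤ r₁.cV := cV_nonneg hr₁
  have hc0 : 0 ≤ B6.c0 1 r₁.η := c0_nonneg hr₁.hη
  have hθ₀ : 0 < θ₀ := theta0Max_pos m ν (KG := q₁.Kbar) (BΓ := q₁.BΓ) hκC hKCs hcE hcV hc0 hmA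
  -- (iv) the record: `M := κw + 1 + M⁴min(rf's letters, a, κ₁t) + 27·m₂·K₂`, then `ε₁` inside `constsQ8A`
  let X : ℝ := m4Min m ν m' (2 / r₁.mA₀) q₁.BΓ r₁.cV (B6.c0 1 r₁.η) r₁.mA₀ a κ₁t
  have hX : 0 ≤ X := m4Min_nonneg m ν m' (BΓ := q₁.BΓ) (κ₁ := κ₁t) hcE hcV hc0 hmA ha.le
  let M : ℝ := κw + 1 + X + 27 * (m₂ : ℝ) * K₂
  have h27 : 0 ≤ 27 * (m₂ : ℝ) * K₂ := by positivity
  have hκw := κw_lower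
  have hM : κw + 1 ≤ M := by show κw + 1 ≤ κw + 1 + X + 27 * (m₂ : ℝ) * K₂; linarith
  have hM1 : (1 : ℝ) ≤ M := by linarith [hκw.1]
  have hM0 : M ≠ 0 := by positivity
  have hspec := constsQ8A_spec hM ha
  obtain ⟨⟨-, h12, -, -, -, hM1', hE, hε, hC₁, hα, -, -⟩, -, ⟨hL8, -⟩⟩ := hspec
  -- (v) the (2.24)–(2.26) letters and the p. 17 coupling
  let γ₂ : ℝ := gamma2Max m ν (2 / r₁.mA₀) q₁.BΓ r₁.cV (B6.c0 1 r₁.η) r₁.mA₀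
  have hγ : 0 < γ₂ := gamma2Max_pos m ν (BΓ := q₁.BΓ) hcE hcV hc0 hmA
  have haw : 0 < aw := aw_pos
  have hs : 0 < Real.sqrt (aw / γ₂) := Real.sqrt_pos.2 (div_pos haw hγ)
  have hPa : aw ≤ γ₂ * Real.sqrt (aw / γ₂) ^ 2 := by
    rw [Real.sq_sqrt (div_pos haw hγ).le]
    exact le_of_eq (by field_simp)
  refine ⟨constsQ8A M a, { constsQ8A M a with κ₁ := κ₁t + 1 }, rf, R₁, θ₀, alphaMax θ₀ R₁ q₁.Kbar, 1 / 2, 3 * (constsQ8A M a).ε₁, 1, γ₂,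
    Real.sqrt (aw / γ₂), ρΔ, ηΔ, 1, 1, ⟨M, a, hM, ha, rfl⟩, ?_, ?_, ?_, ?_, ⟨one_pos, le_rfl⟩, ?_, ?_, ?_⟩
  · -- (1)
    exact ⟨constsQ8A_numerics hM ha, constsQ8A_invTau_zero hM ha, h12, hL8, hE, hε, hC₁, hα, hM1'⟩
  · -- (2) `hK hK' hθ₁0 hθ₁1 hC`
    exact ⟨hK.le, hK'.le, by norm_num, by norm_num, constsQ8A_hC hM0 le_rfl⟩
  · -- (2) `hK₂ hR hε3 hfloor`
    refine ⟨hK₂.le, by positivity, le_rfl, constsQ8A_hfloor hK₂.le hM1 ?_⟩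
    show 27 * (m₂ : ℝ) * K₂ ≤ κw + 1 + X + 27 * (m₂ : ℝ) * K₂
    linarith [hκw.1]
  · -- (2) `hκp`
    show κ₁t < κ₁t + 1
    linarith
  · -- (3) the rung at `rf` (every derived letter of `rf` is the corresponding letter of `r₁`: `R_σ` is read by nothing)
    refine ⟨hrf, rfl, positiveRates_refPackageJoint R₁, ?_, rfl, hθ₀, alphaMax_pos hθ₀ hR₁ hKbar, le_rfl, le_rfl, le_rfl, ?_, ?_, ?_, ?_, ?_, ?_, ?_⟩
    · show η₀ ≤ (rf.toWalkPackage R₁).etaMax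
      rw [etaMax_refPackageJoint_eq]
    · show (1 : ℝ) ≤ 1; exact le_rfl
    · show (1 : ℝ) ≤ 1; exact le_rfl
    · show F ≤ F; exact le_rfl
    · show (1 : ℝ) ≤ 1; exact le_rfl
    · show (1 : ℝ) ≤ 1; exact le_rfl
    · show F ≤ F; exact le_rfl
    · show (1 : ℝ) ≤ 2; norm_num
  · -- (4) NODE A's budget and floor
    refine ⟨?_, ?_, one_pos, ?_, le_rfl⟩
    · show 0 < 2 * (κ₁t + 1)
      linarith [hκ₁.2]
    · show 2 * (κ₁t + 1) ≤ 2 * (κ₁t + 1) * 1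
      linarith
    · show ηΔ + 1 + 1 + 4 * 1 ≤ ρΔ
      exact le_rfl
  · -- (5)
    refine ⟨hγ, le_rfl, ?_, hs, hPa⟩
    show X ≤ M ^ 4
    have h4 : M ≤ M ^ 4 := by
      calc M = M ^ 1 := (pow_one M).symm
        _ ≤ M ^ 4 := pow_le_pow_right₀ hM1 (by norm_num)
    have hXM : X ≤ M := by show X ≤ κw + 1 + X + 27 * (m₂ : ℝ) * K₂; linarith [hκw.1]
    exact hXM.trans h4

/-! ## §5. THE OTHER DIRECTION (v1.1): activity letter GIVEN, prefactors PRODUCED — the branch compatible with `hcount` -/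

section Activity

variable {M a : ℝ}

/-- The (1.36) constant inequality `hC` at `θ₁ = ½` on the family, for ANY prefactors within the dial's budget: if
`K·(K₀(64,8)·2(6·8)⁴·e·e^{κ₁t(12⁴−1)∕8}) ≤ ½·aε₁t e^{κ₁t}` and `2·64K′·K₀(64,8)·1344 ≤ ½·aε₁t e^{κ₁t}` then `hC` holds at `constsQ8A M a` (`M ≠ 0`).
[cite: Balaban1988RG2Cluster, (1.36) p.9, (2.18) p.16, p.21 (closing paragraph)] -/
theorem constsQ8A_hC_of_le {K K' : ℝ} (hM0 : M ≠ 0)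
    (hK : K * (K₀ 64 8 * (2 * (6 * ((8 : ℕ) : ℝ)) ^ 4) * Real.exp 1 * Real.exp ((1 / 8) * κ₁t * (12 ^ 4 - 1))) ≤
      a * ε₁t * Real.exp κ₁t / 2)
    (hK' : 2 * (64 * K') * K₀ 64 8 * 1344 ≤ a * ε₁t * Real.exp κ₁t / 2) :
    K * K₀ 64 8 * (2 * (6 * (((constsQ8A M a).L : ℕ) : ℝ)) ^ 4) * Real.exp 1 * Real.exp ((1 / 8) * (constsQ8A M a).κ₁ * (12 ^ 4 - 1)) +
        2 * (64 * K') * K₀ 64 8 * 1344 ≤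
      (1 - 1 / 2) * ((constsQ8A M a).E₀ * (constsQ8A M a).ε₁ * (constsQ8A M a).C₁ * (constsQ8A M a).M ^ (constsQ8A M a).q *
        Real.exp ((constsQ8A M a).C₂ * (constsQ8A M a).κ₁)) := by
  rw [constsQ8A_EM hM0]
  show K * K₀ 64 8 * (2 * (6 * ((8 : ℕ) : ℝ)) ^ 4) * Real.exp 1 * Real.exp ((1 / 8) * κ₁t * (12 ^ 4 - 1)) +
        2 * (64 * K') * K₀ 64 8 * 1344 ≤ (1 - 1 / 2) * (2 * a * ε₁t * Real.exp κ₁t)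
  have h1 : K * K₀ 64 8 * (2 * (6 * ((8 : ℕ) : ℝ)) ^ 4) * Real.exp 1 * Real.exp ((1 / 8) * κ₁t * (12 ^ 4 - 1)) =
      K * (K₀ 64 8 * (2 * (6 * ((8 : ℕ) : ℝ)) ^ 4) * Real.exp 1 * Real.exp ((1 / 8) * κ₁t * (12 ^ 4 - 1))) := by ring
  rw [h1]
  linarith

/-- ★★ **JOINT NON-VACUITY, ACTIVITY LETTER GIVEN.**  The converse branch of `junction_numerals_joint_witness`: for EVERY activity letter
`0 < α₄` (as small as the count binder `hcount` of the junction wants, §1 remark 2), every `K₂ > 0`, `m₂`, and every choice of NODE A's letters,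
there are POSITIVE prefactors `K K′` — explicitly `K := α₄ε₁t e^{κ₁t}∕(2P)`, `K′ := α₄ε₁t e^{κ₁t}∕(2P′)` with `P := K₀(64,8)·2(6·8)⁴·e·e^{(12⁴−1)κ₁t∕8}`,
`P′ := 2·64·1344·K₀(64,8)` — and ONE record `c = constsQ8A M α₄` (so `c.α₄ = α₄` and the 69 conjuncts, `constsQ8A_spec`), ONE `cp`, ONE admissible
reference package and the remaining letters meeting ALL of (1)–(5) of `junction_numerals_joint_witness` in the same shapes.  This is the branch a
future inhabitant WITH objects needs (small `α₄`, prefactors `ε₁·O(1)·e^{−C₂κ₁}`-small — print p. 8 (1.29): the per-term bounds carry `E₀ε₁`).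
[cite: Balaban1988RG2Cluster, (1.29) p.8, Lemma 1 (1.36) p.9, Lemma 2 (1.43) p.11, p.13, p.15, (2.16)–(2.18) p.16, (2.24)-(2.26) p.17, p.21 (closing paragraph); Balaban1985BackgroundPropagators, Thm 3.10 p.416; Balaban1984PropagatorsII, Lemma 2.1 (2.61) p.234] -/
theorem junction_numerals_joint_witness_of_activity {a K₂ : ℝ} (ha : 0 < a) (hK₂ : 0 < K₂) (m₂ : ℕ)
    (m ν m' mF c₀ : ℕ) (rC : ℝ) {BΔ : ℝ} (hB : 0 ≤ BΔ) :
    ∃ (c cp : B13.Consts) (rf : RefPackage) (K K' R₁ θ₀ α θ₁ R r γ₂ rP ρΔ ηΔ μΔ M₁ : ℝ),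
      -- (0) the record is the member of the family AT THE GIVEN DIAL; the prefactors are positive and explicit
      (∃ M : ℝ, κw + 1 ≤ M ∧ c = constsQ8A M a) ∧ c.α₄ = a ∧
      (0 < K ∧ K = a * ε₁t * Real.exp κ₁t / (2 * (K₀ 64 8 * (2 * (6 * ((8 : ℕ) : ℝ)) ^ 4) * Real.exp 1 * Real.exp ((1 / 8) * κ₁t * (12 ^ 4 - 1)))) ∧
        0 < K' ∧ K' = a * ε₁t * Real.exp κ₁t / (2 * (2 * 64 * 1344 * K₀ 64 8))) ∧
      -- (1) the junction's `hN`, `hτ2`, `h12`, `hL8`, `hE hε hC₁ hα hM`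
      (Lemma3Numerics c 1 ((c.L : ℝ) / 2) aw 1 1 (1 / 2) 1 ∧
        c.E₀ * c.ε₁ * c.C₁ * c.α₄⁻¹ * c.M ^ c.q * Real.exp (c.C₂ * c.κ₁) ≤ 1 / 2 ∧
        R12 c ∧ 8 ≤ c.L ∧ 0 < c.E₀ ∧ 0 < c.ε₁ ∧ 0 < c.C₁ ∧ 0 < c.α₄ ∧ 1 ≤ c.M) ∧
      -- (2) the Lemma 1–2 located NUMERICAL inputs at these prefactors: `hK hK' hθ₁0 hθ₁1 hC`, `hK₂ hR hε3 hfloor`, `hκp`, `hr hr1`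
      (0 ≤ K ∧ 0 ≤ K' ∧ 0 ≤ θ₁ ∧ θ₁ < 1 ∧
        K * K₀ 64 8 * (2 * (6 * ((c.L : ℕ) : ℝ)) ^ 4) * Real.exp 1 * Real.exp ((1 / 8) * c.κ₁ * (12 ^ 4 - 1)) +
            2 * (64 * K') * K₀ 64 8 * 1344 ≤
          (1 - θ₁) * (c.E₀ * c.ε₁ * c.C₁ * c.M ^ c.q * Real.exp (c.C₂ * c.κ₁))) ∧
      (0 ≤ K₂ ∧ 0 < R ∧ 3 * c.ε₁ ≤ R ∧ 27 * m₂ * K₂ * Real.exp (c.κ₁ - 1) ≤ c.C₃ * c.M ^ 4 * Real.exp (c.C₂ * c.κ₁)) ∧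
      c.κ₁ < cp.κ₁ ∧ (0 < r ∧ r ≤ 1) ∧
      -- (3) the rung at ONE admissible reference package, dials located
      (rf.Admissible ∧ R₁ = radiusStar rf.R rf.m₀ rf.mA₀ rf.KbarP rf.KbarA rf.cV rf.cV₀ ∧
        (rf.toWalkPackage R₁).PositiveRates ∧ rf.η ≤ (rf.toWalkPackage R₁).etaMax ∧
        θ₀ = theta0Max m ν (rf.toWalkPackage R₁).kapCStar (rf.toWalkPackage R₁).Kbar (8 / rf.mA₀) (2 / rf.mA₀)
          (rf.toWalkPackage R₁).BΓ rf.cV (B6.c0 1 rf.η) rf.mA₀ ∧ 0 < θ₀ ∧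
        0 < α ∧ α ≤ alphaMax θ₀ R₁ (rf.toWalkPackage R₁).Kbar ∧
        rsigmaMin θ₀ (rf.toWalkPackage R₁).Kbar (rf.toWalkPackage R₁).mu (rf.toWalkPackage R₁).kapCStar rf.m₀ rf.mA₀ rf.KbarP rf.KbarA
          rf.cV rf.cV₀ rf.εP rf.εA ≤ rf.Rσ ∧
        ν ≤ rf.dm ∧ rf.εL ≤ rf.εP ∧ rf.kapL ≤ rf.kapP ∧ rf.KbarP ≤ rf.KbarL ∧ rf.εA ≤ rf.εP ∧ rf.kapA ≤ rf.kapP ∧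
        rf.KbarP ≤ rf.KbarA ∧ rf.mA₀ ≤ rf.m₀) ∧
      -- (4) NODE A's rate budget and expansion-constant floor at `cp.κ₁`
      (0 < ηΔ ∧ 2 * cp.κ₁ ≤ ηΔ * M₁ ∧ 0 < μΔ ∧ ηΔ + rf.εP + rf.kapP + 4 * μΔ ≤ ρΔ ∧
        kbarFloor ν mF c₀ ρΔ ηΔ μΔ rC cp.κ₁ BΔ ≤ rf.KbarP) ∧
      -- (5) the (2.24)–(2.26) located numerals at rf's letters and the record's own `α₄ M κ₁` + p. 17's `a ≤ γ₂ r_P²`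
      (0 < γ₂ ∧ γ₂ ≤ gamma2Max m ν (2 / rf.mA₀) (rf.toWalkPackage R₁).BΓ rf.cV (B6.c0 1 rf.η) rf.mA₀ ∧
        m4Min m ν m' (2 / rf.mA₀) (rf.toWalkPackage R₁).BΓ rf.cV (B6.c0 1 rf.η) rf.mA₀ c.α₄ c.κ₁ ≤ c.M ^ 4 ∧
        0 < rP ∧ aw ≤ γ₂ * rP ^ 2) := by
  -- (i) the prefactors from the dial
  have hε₁t : 0 < ε₁t := ε₁t_pos'
  have hK₀ : 0 < K₀ 64 8 := K₀_pos 64 8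
  have hS : 0 < a * ε₁t * Real.exp κ₁t := mul_pos (mul_pos ha hε₁t) (Real.exp_pos _)
  have hP : 0 < K₀ 64 8 * (2 * (6 * ((8 : ℕ) : ℝ)) ^ 4) * Real.exp 1 * Real.exp ((1 / 8) * κ₁t * (12 ^ 4 - 1)) := by positivity
  have hP' : 0 < 2 * 64 * 1344 * K₀ 64 8 := by positivity
  let K : ℝ := a * ε₁t * Real.exp κ₁t / (2 * (K₀ 64 8 * (2 * (6 * ((8 : ℕ) : ℝ)) ^ 4) * Real.exp 1 * Real.exp ((1 / 8) * κ₁t * (12 ^ 4 - 1))))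
  let K' : ℝ := a * ε₁t * Real.exp κ₁t / (2 * (2 * 64 * 1344 * K₀ 64 8))
  have hK : 0 < K := div_pos hS (by positivity)
  have hK' : 0 < K' := div_pos hS (by positivity)
  have hKle : K * (K₀ 64 8 * (2 * (6 * ((8 : ℕ) : ℝ)) ^ 4) * Real.exp 1 * Real.exp ((1 / 8) * κ₁t * (12 ^ 4 - 1))) ≤
      a * ε₁t * Real.exp κ₁t / 2 := by
    show a * ε₁t * Real.exp κ₁t / (2 * (K₀ 64 8 * (2 * (6 * ((8 : ℕ) : ℝ)) ^ 4) * Real.exp 1 * Real.exp ((1 / 8) * κ₁t * (12 ^ 4 - 1)))) *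
        (K₀ 64 8 * (2 * (6 * ((8 : ℕ) : ℝ)) ^ 4) * Real.exp 1 * Real.exp ((1 / 8) * κ₁t * (12 ^ 4 - 1))) ≤ a * ε₁t * Real.exp κ₁t / 2
    exact le_of_eq (by field_simp)
  have hK'le : 2 * (64 * K') * K₀ 64 8 * 1344 ≤ a * ε₁t * Real.exp κ₁t / 2 := by
    show 2 * (64 * (a * ε₁t * Real.exp κ₁t / (2 * (2 * 64 * 1344 * K₀ 64 8)))) * K₀ 64 8 * 1344 ≤ a * ε₁t * Real.exp κ₁t / 2
    exact le_of_eq (by field_simp)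
  -- (ii) `cp.κ₁ := κ₁t + 1`, NODE A's rates, the floor `F`
  have hκ₁ := one_le_κ₁t
  let ηΔ : ℝ := 2 * (κ₁t + 1)
  let ρΔ : ℝ := ηΔ + 1 + 1 + 4 * 1
  let F : ℝ := kbarFloor ν mF c₀ ρΔ ηΔ 1 rC (κ₁t + 1) BΔ
  have hF : 0 ≤ F := kbarFloor_nonneg hB
  -- (iii) the package
  let η₀ : ℝ := ((refPackageJoint ν F 1 0).toWalkPackage 1).etaMax
  obtain ⟨hη₀, hη₀1⟩ : 0 < η₀ ∧ η₀ ≤ 1 := etaMax_refPackageJoint_pos_le hF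
  let r₁ : RefPackage := refPackageJoint ν F η₀ 0
  let R₁ : ℝ := radiusStar r₁.R r₁.m₀ r₁.mA₀ r₁.KbarP r₁.KbarA r₁.cV r₁.cV₀
  let q₁ : WalkPackage := r₁.toWalkPackage R₁
  let θ₀ : ℝ := theta0Max m ν q₁.kapCStar q₁.Kbar (8 / r₁.mA₀) (2 / r₁.mA₀) q₁.BΓ r₁.cV (B6.c0 1 r₁.η) r₁.mA₀
  let Rσ : ℝ := rsigmaMin θ₀ q₁.Kbar q₁.mu q₁.kapCStar r₁.m₀ r₁.mA₀ r₁.KbarP r₁.KbarA r₁.cV r₁.cV₀ r₁.εP r₁.εA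
  let rf : RefPackage := refPackageJoint ν F η₀ Rσ
  have hr₁ : r₁.Admissible := refPackageJoint_admissible hF hη₀ hη₀1
  have hrf : rf.Admissible := refPackageJoint_admissible hF hη₀ hη₀1
  have hR₁ : 0 < R₁ := radiusStar_pos hr₁.hR hr₁.hm₀ hr₁.hmA₀ hr₁.hKbarP hr₁.hKbarA (cV_nonneg hr₁) (cV₀_nonneg hr₁)
  have hq₁ : q₁.Admissible := admissible_toWalkPackage hr₁ hR₁
  have hp₁ : q₁.PositiveRates := positiveRates_refPackageJoint R₁
  have hκC : 0 < q₁.kapCStar := (kapCStar_spec hq₁ (rhoE_pos hp₁) (mu_pos hq₁ hp₁)).1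
  have hKbar : 0 ≤ q₁.Kbar := Kbar_nonneg hq₁
  have hmA : (0 : ℝ) < r₁.mA₀ := hr₁.hmA₀
  have hcE : (0 : ℝ) ≤ 2 / r₁.mA₀ := div_nonneg (by norm_num) hmA.le
  have hKCs : (0 : ℝ) ≤ 8 / r₁.mA₀ := div_nonneg (by norm_num) hmA.le
  have hcV : 0 ≤ r₁.cV := cV_nonneg hr₁
  have hc0 : 0 ≤ B6.c0 1 r₁.η := c0_nonneg hr₁.hη
  have hθ₀ : 0 < θ₀ := theta0Max_pos m ν (KG := q₁.Kbar) (BΓ := q₁.BΓ) hκC hKCs hcE hcV hc0 hmA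
  -- (iv) the record at the GIVEN dial
  let X : ℝ := m4Min m ν m' (2 / r₁.mA₀) q₁.BΓ r₁.cV (B6.c0 1 r₁.η) r₁.mA₀ a κ₁t
  have hX : 0 ≤ X := m4Min_nonneg m ν m' (BΓ := q₁.BΓ) (κ₁ := κ₁t) hcE hcV hc0 hmA ha.le
  let M : ℝ := κw + 1 + X + 27 * (m₂ : ℝ) * K₂
  have h27 : 0 ≤ 27 * (m₂ : ℝ) * K₂ := by positivity
  have hκw := κw_lower
  have hM : κw + 1 ≤ M := by show κw + 1 ≤ κw + 1 + X + 27 * (m₂ : ℝ) * K₂; linarith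
  have hM1 : (1 : ℝ) ≤ M := by linarith [hκw.1]
  have hM0 : M ≠ 0 := by positivity
  obtain ⟨⟨-, h12, -, -, -, hM1', hE, hε, hC₁, hα, -, -⟩, -, ⟨hL8, -⟩⟩ := constsQ8A_spec hM ha
  -- (v) the (2.24)–(2.26) letters and the p. 17 coupling
  let γ₂ : ℝ := gamma2Max m ν (2 / r₁.mA₀) q₁.BΓ r₁.cV (B6.c0 1 r₁.η) r₁.mA₀
  have hγ : 0 < γ₂ := gamma2Max_pos m ν (BΓ := q₁.BΓ) hcE hcV hc0 hmA
  have haw : 0 < aw := aw_pos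
  have hs : 0 < Real.sqrt (aw / γ₂) := Real.sqrt_pos.2 (div_pos haw hγ)
  have hPa : aw ≤ γ₂ * Real.sqrt (aw / γ₂) ^ 2 := by
    rw [Real.sq_sqrt (div_pos haw hγ).le]
    exact le_of_eq (by field_simp)
  refine ⟨constsQ8A M a, { constsQ8A M a with κ₁ := κ₁t + 1 }, rf, K, K', R₁, θ₀, alphaMax θ₀ R₁ q₁.Kbar, 1 / 2, 3 * (constsQ8A M a).ε₁, 1,
    γ₂, Real.sqrt (aw / γ₂), ρΔ, ηΔ, 1, 1, ⟨M, hM, rfl⟩, rfl, ⟨hK, rfl, hK', rfl⟩, ?_, ?_, ?_, ?_, ⟨one_pos, le_rfl⟩, ?_, ?_, ?_⟩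
  · exact ⟨constsQ8A_numerics hM ha, constsQ8A_invTau_zero hM ha, h12, hL8, hE, hε, hC₁, hα, hM1'⟩
  · exact ⟨hK.le, hK'.le, by norm_num, by norm_num, constsQ8A_hC_of_le hM0 hKle hK'le⟩
  · refine ⟨hK₂.le, by positivity, le_rfl, constsQ8A_hfloor hK₂.le hM1 ?_⟩
    show 27 * (m₂ : ℝ) * K₂ ≤ κw + 1 + X + 27 * (m₂ : ℝ) * K₂
    linarith [hκw.1]
  · show κ₁t < κ₁t + 1
    linarith
  · refine ⟨hrf, rfl, positiveRates_refPackageJoint R₁, ?_, rfl, hθ₀, alphaMax_pos hθ₀ hR₁ hKbar, le_rfl, le_rfl, le_rfl,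
      ?_, ?_, ?_, ?_, ?_, ?_, ?_⟩
    · show η₀ ≤ (rf.toWalkPackage R₁).etaMax
      rw [etaMax_refPackageJoint_eq]
    · show (1 : ℝ) ≤ 1; exact le_rfl
    · show (1 : ℝ) ≤ 1; exact le_rfl
    · show F ≤ F; exact le_rfl
    · show (1 : ℝ) ≤ 1; exact le_rfl
    · show (1 : ℝ) ≤ 1; exact le_rfl
    · show F ≤ F; exact le_rfl
    · show (1 : ℝ) ≤ 2; norm_num
  · refine ⟨?_, ?_, one_pos, ?_, le_rfl⟩
    · show 0 < 2 * (κ₁t + 1)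
      linarith [hκ₁.2]
    · show 2 * (κ₁t + 1) ≤ 2 * (κ₁t + 1) * 1
      linarith
    · show ηΔ + 1 + 1 + 4 * 1 ≤ ρΔ
      exact le_rfl
  · refine ⟨hγ, le_rfl, ?_, hs, hPa⟩
    show X ≤ M ^ 4
    have h4 : M ≤ M ^ 4 := by
      calc M = M ^ 1 := (pow_one M).symm
        _ ≤ M ^ 4 := pow_le_pow_right₀ hM1 (by norm_num)
    have hXM : X ≤ M := by show X ≤ κw + 1 + X + 27 * (m₂ : ℝ) * K₂; linarith [hκw.1]
    exact hXM.trans h4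

end Activity

end Literature.MathematicalPhysics.QuantumFieldTheory.Balaban1983to89.B13ChainJointNonvacuityPrefactors

end
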